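import Literature.Analysis.FluidPDE.ElgindiPolarRadialEstimate
import Literature.Analysis.FluidPDE.ElgindiPolarEnergyTwoWeighted
import Literature.Analysis.FluidPDE.ElgindiRadialWeightCalculus
import HarnessLib

/-!
# Proposition 7.7 Step 1 of [Elgindi2021]: the radially weighted a-priori estimate

Topic `Literature/Analysis/FluidPDE`. Proof file (everything proved, no definitions, no named
facts) on the proof path of the named fact
`Literature.Analysis.FluidPDE.Elgindi.ElgindiGhoulMasmoudi2021_stabilityCore`
(`ElgindiStabilityDecomposition.lean`). T. M. Elgindi, Ann. of Math. 194 (2021) =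
arXiv:1904.04795, §7.3 proof of Proposition 7.7, Step 1 "Only radial weights" (pp. 20–21):

> "In particular, since `0 ≤ α ≤ ¼` we see: `|∂_θθΨw|² − 9.5|Ψw|² ≤ |(Fw,Ψw)_{L²}|`. Now we argue
> as in Step 2 of the proof of Proposition 7.1. Using that `wΨ_⋆ ≡ 0` … Now the proof follows the
> same as before to give: `α²|R²∂_RRΨw|_{L²} + |∂_θθΨw|_{L²} ≤ C₁|Fw|_{L²}`."

A-priori form with `w = (1+R)²/R²` (`radialWeight`), for `0 < α ≤ ¼`, `Ψ = cosθ·χ`, `χ ∈ C³(ℝ²)`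
compactly supported inside `R > 0` with `χ(R,0) = 0`, `F = L(Ψ)` orthogonal to `K` on every slice:
from the two weighted energy identities (`ElgindiPolarEnergyWeighted.lean`,
`ElgindiPolarEnergyTwoWeighted.lean`), the weight bounds `0 ≤ ∂²(R²w²) ≤ 6w²`, `|∂(Rw²)| ≤ 3w²`,
and the constrained Poincaré inequality slice by slice (the printed `9.5 < 12`):
`‖wΨ_θ‖² ≤ ‖wF‖²`, `‖wΨ‖² ≤ ‖wF‖²/12`, `‖wΨ_θθ‖² ≤ 12‖wF‖²`, `‖w∂_θ(Ψ/cosθ)‖² ≤ 8‖wF‖²`,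
`α²‖wR∂_RΨ‖² ≤ ‖wF‖²`, `α⁴‖wR²∂_RRΨ‖² ≤ 372‖wF‖²`, `α²‖wR∂_RθΨ‖² ≤ 12‖wF‖²`, `‖wχ‖² ≤ 2‖wF‖²` (`polar_weighted_apriori_estimate`).
-/

noncomputable section

open MeasureTheory Set Real Filter Function intervalIntegral
open _root_.Topology

namespace Literature.Analysis.FluidPDE

namespace Elgindi

/-! ### Pure real algebra of the two absorption steps -/

/-- `(19/60)Y ≤ I`, `I² ≤ LE`, `E ≤ Y/12` give `Y ≤ L`. [folklore] -/
theorem weighted_l2_algebra {Y I L E : ℝ} (hL : 0 ≤ L)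
    (hc : (19 / 60) * Y ≤ I) (hI : I ^ 2 ≤ L * E) (hE : E ≤ Y / 12) : Y ≤ L := by
  by_contra hlt
  have hlt' : L < Y := not_le.1 hlt
  have hYpos : 0 < Y := lt_of_le_of_lt hL hlt'
  have h1 : ((19 / 60) * Y) ^ 2 ≤ L * (Y / 12) :=
    (pow_le_pow_left₀ (by positivity) hc 2).trans (hI.trans (mul_le_mul_of_nonneg_left hE hL))
  nlinarith

/-- `P + (3/2)Q ≤ I + (41/5)Y`, `I² ≤ LP`, `Y ≤ L` give `P ≤ 12L`, `Q ≤ 8L`. [folklore] -/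
theorem weighted_h2_algebra {P Q I L Y : ℝ} (hP : 0 ≤ P) (hQ : 0 ≤ Q) (hL : 0 ≤ L)
    (hmain : P + (3 / 2) * Q ≤ I + (41 / 5) * Y) (hI : I ^ 2 ≤ L * P) (hY : Y ≤ L) : P ≤ 12 * L ∧ Q ≤ 8 * L := by
  have hPle : P ≤ 12 * L := by
    by_contra hlt
    have hlt' : 12 * L < P := not_le.1 hlt
    have h1 : P - (41 / 5) * L ≤ I := by nlinarith
    have h2 : 0 ≤ P - (41 / 5) * L := by nlinarith
    have h3 := (pow_le_pow_left₀ h2 h1 2).trans hI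
    nlinarith
  refine ⟨hPle, ?_⟩
  have hI4 : I ≤ 4 * L := by
    by_contra hlt
    have hlt' : 4 * L < I := not_le.1 hlt
    have := hI.trans (mul_le_mul_of_nonneg_left hPle hL)
    nlinarith
  nlinarith

/-- The mixed-derivative absorption: `Z + P + (3/2)Q ≤ I + (41/5)Y`, `I² ≤ LP`, `P ≤ 12L`, `Y ≤ L`
give `Z ≤ 12L`. [folklore] -/
theorem weighted_mixed_algebra {Z P Q I L Y : ℝ} (hP : 0 ≤ P) (hQ : 0 ≤ Q) (hL : 0 ≤ L)
    (hmain : Z + P + (3 / 2) * Q ≤ I + (41 / 5) * Y) (hI : I ^ 2 ≤ L * P) (hPL : P ≤ 12 * L) (hY : Y ≤ L) :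
    Z ≤ 12 * L := by
  have hI72 : I ≤ (7 / 2) * L := by
    by_contra hlt
    have hlt' : (7 / 2) * L < I := not_le.1 hlt
    have h1 : ((7 / 2) * L) ^ 2 < I ^ 2 := pow_lt_pow_left₀ hlt' (by positivity) two_ne_zero
    nlinarith
  nlinarith

/-- The Step-1 coefficient bound for `0 ≤ α ≤ ¼`: `3α² + (3/2)α(5+α) ≤ 11/5`. [folklore] -/
theorem step1_coef_bound {α : ℝ} (hα : 0 ≤ α) (hα4 : α ≤ 1 / 4) : α ^ 2 / 2 * 6 + α * (5 + α) / 2 * 3 ≤ 11 / 5 := by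
  nlinarith

/-! ### The weight `w² = (1+R)⁴/R⁴` -/

/-- `w²` is smooth on `(0,∞)`. [folklore] -/
theorem contDiffOn_radialWeight_sq {n : WithTop ℕ∞} : ContDiffOn ℝ n (fun R : ℝ => radialWeight R ^ 2) (Ioi 0) := by
  unfold radialWeight
  have h : ContDiffOn ℝ n (fun R : ℝ => (1 + R) ^ 2 / R ^ 2) (Ioi 0) :=
    ContDiffOn.div (by fun_prop) (by fun_prop) fun R hR => pow_ne_zero 2 (ne_of_gt hR)
  exact h.pow 2

/-! ### Proposition 7.7, Step 1 -/

/-- **Proposition 7.7, Step 1 (radially weighted a-priori estimate)**: `w = (1+R)²/R²`,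
`0 < α ≤ ¼`, `Ψ = cosθ·χ` with `χ ∈ C³(ℝ²)` compactly supported inside `R > 0` and `χ(R,0) = 0`,
`F = L(Ψ)` with `∫₀^{π/2}F(R,·)K = 0` for `R > 0`. Then, with all norms in `L²(dRdθ)` of the strip,
`‖wΨ_θ‖² ≤ ‖wF‖²`, `‖wΨ‖² ≤ ‖wF‖²/12`, `‖wΨ_θθ‖² ≤ 12‖wF‖²`, `‖wχ_θ‖² ≤ 8‖wF‖²`,
`α²‖wRΨ_R‖² ≤ ‖wF‖²`, `α⁴‖wR²Ψ_RR‖² ≤ 372‖wF‖²`, `α²‖wRΨ_{Rθ}‖² ≤ 12‖wF‖²` and `‖wχ‖² ≤ 2‖wF‖²`. [cite: Elgindi2021, §7.3 proof of Proposition 7.7, Step 1 (pp. 20–21 of arXiv:1904.04795)] -/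
theorem polar_weighted_apriori_estimate {α : ℝ} (hα : 0 < α) (hα4 : α ≤ 1 / 4) {χ : ℝ → ℝ → ℝ}
    (hχ : ContDiff ℝ 3 (uncurry χ)) (hs : HasCompactSupport (uncurry χ)) (hpos : ∀ p ∈ tsupport (uncurry χ), 0 < p.1)
    (hχ0 : ∀ R, χ R 0 = 0) {Ψ : ℝ → ℝ → ℝ} (hΨ : Ψ = fun R θ => Real.cos θ * χ R θ)
    (horth : ∀ R, 0 < R → ∫ θ in Ioo 0 (π / 2), ellipticOp α Ψ R θ * kernelK θ = 0) :
    (∫ p in strip, radialWeight p.1 ^ 2 * dθ Ψ p.1 p.2 ^ 2) ≤ ∫ p in strip, radialWeight p.1 ^ 2 * ellipticOp α Ψ p.1 p.2 ^ 2 ∧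
    (∫ p in strip, radialWeight p.1 ^ 2 * Ψ p.1 p.2 ^ 2) ≤ (1 / 12) * ∫ p in strip, radialWeight p.1 ^ 2 * ellipticOp α Ψ p.1 p.2 ^ 2 ∧
    (∫ p in strip, radialWeight p.1 ^ 2 * dθ (dθ Ψ) p.1 p.2 ^ 2) ≤ 12 * ∫ p in strip, radialWeight p.1 ^ 2 * ellipticOp α Ψ p.1 p.2 ^ 2 ∧
    (∫ p in strip, radialWeight p.1 ^ 2 * dθ χ p.1 p.2 ^ 2) ≤ 8 * ∫ p in strip, radialWeight p.1 ^ 2 * ellipticOp α Ψ p.1 p.2 ^ 2 ∧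
    α ^ 2 * (∫ p in strip, radialWeight p.1 ^ 2 * (p.1 * dz Ψ p.1 p.2) ^ 2) ≤ ∫ p in strip, radialWeight p.1 ^ 2 * ellipticOp α Ψ p.1 p.2 ^ 2 ∧
    α ^ 4 * (∫ p in strip, radialWeight p.1 ^ 2 * (p.1 ^ 2 * dz (dz Ψ) p.1 p.2) ^ 2) ≤
      372 * ∫ p in strip, radialWeight p.1 ^ 2 * ellipticOp α Ψ p.1 p.2 ^ 2 ∧
    α ^ 2 * (∫ p in strip, radialWeight p.1 ^ 2 * (p.1 * dz (dθ Ψ) p.1 p.2) ^ 2) ≤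
      12 * ∫ p in strip, radialWeight p.1 ^ 2 * ellipticOp α Ψ p.1 p.2 ^ 2 ∧
    (∫ p in strip, radialWeight p.1 ^ 2 * χ p.1 p.2 ^ 2) ≤ 2 * ∫ p in strip, radialWeight p.1 ^ 2 * ellipticOp α Ψ p.1 p.2 ^ 2 := by
  have hα1 : α ≤ 1 := by linarith
  -- the weight
  set W : ℝ → ℝ := fun R => radialWeight R ^ 2 with hW
  have hWd : ContDiffOn ℝ 2 W (Ioi 0) := contDiffOn_radialWeight_sq
  have hWc : ContinuousOn W (Ioi 0) := hWd.continuousOn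
  have hWnn : ∀ R, 0 ≤ W R := fun R => sq_nonneg _
  have hM2 : ∀ R, 0 < R → 0 ≤ deriv (deriv fun R => R ^ 2 * W R) R ∧ deriv (deriv fun R => R ^ 2 * W R) R ≤ 6 * W R :=
    fun R hR => deriv2_sq_mul_radialWeight_sq_bounds hR
  have hN1 : ∀ R, 0 < R → |deriv (fun R => R * W R) R| ≤ 3 * W R := fun R hR => abs_deriv_mul_radialWeight_sq_le hR
  have hW1 : ContDiffOn ℝ 1 W (Ioi 0) := hWd.of_le (by norm_num)
  have hMd1 : ContDiffOn ℝ 1 (deriv fun R => R ^ 2 * W R) (Ioi 0) :=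
    ((contDiffOn_id.pow 2).mul hWd).deriv_of_isOpen (m := 1) isOpen_Ioi (by norm_num)
  have hM2c : ContinuousOn (deriv (deriv fun R => R ^ 2 * W R)) (Ioi 0) :=
    (hMd1.deriv_of_isOpen (m := 0) isOpen_Ioi (by norm_num)).continuousOn
  have hNd1 : ContDiffOn ℝ 1 (fun R => R * W R) (Ioi 0) := contDiffOn_id.mul hW1
  have hN1c : ContinuousOn (deriv fun R => R * W R) (Ioi 0) := (hNd1.deriv_of_isOpen (m := 0) isOpen_Ioi (by norm_num)).continuousOn
  -- regularity
  have hχ2 : ContDiff ℝ 2 (uncurry χ) := hχ.of_le (by norm_num)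
  have hχ1 : ContDiff ℝ 1 (uncurry χ) := hχ.of_le (by norm_num)
  have hΨ3 : ContDiff ℝ 3 (uncurry Ψ) := by rw [hΨ]; exact contDiff_cosProfile hχ
  have hΨ2 : ContDiff ℝ 2 (uncurry Ψ) := hΨ3.of_le (by norm_num)
  have hΨs : HasCompactSupport (uncurry Ψ) := by rw [hΨ]; exact hasCompactSupport_cosProfile hs
  have hdzΨ : ContDiff ℝ 2 (uncurry (dz Ψ)) := contDiff_dz_of_contDiff (n := 2) hΨ3
  have hdz2Ψ : ContDiff ℝ 1 (uncurry (dz (dz Ψ))) := contDiff_dz_of_contDiff (n := 1) hdzΨ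
  have hdθΨ : ContDiff ℝ 2 (uncurry (dθ Ψ)) := contDiff_dθ_of_contDiff (n := 2) hΨ3
  have hdθ2Ψ : ContDiff ℝ 1 (uncurry (dθ (dθ Ψ))) := contDiff_dθ_of_contDiff (n := 1) hdθΨ
  have hdzdθΨ : ContDiff ℝ 1 (uncurry (dz (dθ Ψ))) := contDiff_dz_of_contDiff (n := 1) hdθΨ
  have hdθχ : ContDiff ℝ 2 (uncurry (dθ χ)) := contDiff_dθ_of_contDiff (n := 2) hχ
  have hdzΨs : HasCompactSupport (uncurry (dz Ψ)) := hasCompactSupport_dz hΨs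
  have hdz2Ψs : HasCompactSupport (uncurry (dz (dz Ψ))) := hasCompactSupport_dz hdzΨs
  have hdθΨs : HasCompactSupport (uncurry (dθ Ψ)) := hasCompactSupport_dθ_of hΨs
  have hdθ2Ψs : HasCompactSupport (uncurry (dθ (dθ Ψ))) := hasCompactSupport_dθ_of hdθΨs
  have hdzdθΨs : HasCompactSupport (uncurry (dz (dθ Ψ))) := hasCompactSupport_dz hdθΨs
  have hdθχs : HasCompactSupport (uncurry (dθ χ)) := hasCompactSupport_dθ_of hs
  have cΨ : Continuous fun p : ℝ × ℝ => Ψ p.1 p.2 := hΨ3.continuous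
  have cχ : Continuous fun p : ℝ × ℝ => χ p.1 p.2 := hχ.continuous
  have cdz : Continuous fun p : ℝ × ℝ => dz Ψ p.1 p.2 := hdzΨ.continuous
  have cdz2 : Continuous fun p : ℝ × ℝ => dz (dz Ψ) p.1 p.2 := hdz2Ψ.continuous
  have cdθ : Continuous fun p : ℝ × ℝ => dθ Ψ p.1 p.2 := hdθΨ.continuous
  have cdθ2 : Continuous fun p : ℝ × ℝ => dθ (dθ Ψ) p.1 p.2 := hdθ2Ψ.continuous
  have cdzdθ : Continuous fun p : ℝ × ℝ => dz (dθ Ψ) p.1 p.2 := hdzdθΨ.continuous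
  have cdθχ : Continuous fun p : ℝ × ℝ => dθ χ p.1 p.2 := hdθχ.continuous
  -- vanishing near the axis
  obtain ⟨a, ha, hva⟩ := exists_pos_forall_fst_lt_eq_zero hs hpos
  have hvaχ : ∀ p : ℝ × ℝ, p.1 < a → χ p.1 p.2 = 0 := fun p hp => hva p hp
  have hvaΨ : ∀ p : ℝ × ℝ, p.1 < a → Ψ p.1 p.2 = 0 := fun p hp => by rw [hΨ]; simp [hvaχ p hp]
  have vanish_of : ∀ (G : ℝ × ℝ → ℝ), (∀ p : ℝ × ℝ, p.1 < a → G p = 0) → ∀ p : ℝ × ℝ, p.1 < a →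
      dθ (fun R θ => G (R, θ)) p.1 p.2 = 0 ∧ dz (fun R θ => G (R, θ)) p.1 p.2 = 0 := by
    intro G hG p hp
    constructor
    · show deriv (fun θ' => G (p.1, θ')) p.2 = 0
      have : (fun θ' => G (p.1, θ')) = fun _ => 0 := funext fun θ' => hG (p.1, θ') hp
      rw [this, deriv_const]
    · show deriv (fun R' => G (R', p.2)) p.1 = 0
      have : (fun R' => G (R', p.2)) =ᶠ[𝓝 p.1] fun _ => 0 :=
        Filter.eventuallyEq_of_mem (Iio_mem_nhds hp) fun R' hR' => hG (R', p.2) hR'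
      rw [this.deriv_eq, deriv_const]
  have hvadθ : ∀ p : ℝ × ℝ, p.1 < a → dθ Ψ p.1 p.2 = 0 := fun p hp => (vanish_of (fun q => Ψ q.1 q.2) hvaΨ p hp).1
  have hvadz : ∀ p : ℝ × ℝ, p.1 < a → dz Ψ p.1 p.2 = 0 := fun p hp => (vanish_of (fun q => Ψ q.1 q.2) hvaΨ p hp).2
  have hvadθ2 : ∀ p : ℝ × ℝ, p.1 < a → dθ (dθ Ψ) p.1 p.2 = 0 := fun p hp => (vanish_of (fun q => dθ Ψ q.1 q.2) hvadθ p hp).1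
  have hvadzdθ : ∀ p : ℝ × ℝ, p.1 < a → dz (dθ Ψ) p.1 p.2 = 0 := fun p hp => (vanish_of (fun q => dθ Ψ q.1 q.2) hvadθ p hp).2
  have hvadz2 : ∀ p : ℝ × ℝ, p.1 < a → dz (dz Ψ) p.1 p.2 = 0 := fun p hp => (vanish_of (fun q => dz Ψ q.1 q.2) hvadz p hp).2
  have hvadθχ : ∀ p : ℝ × ℝ, p.1 < a → dθ χ p.1 p.2 = 0 := fun p hp => (vanish_of (fun q => χ q.1 q.2) hvaχ p hp).1
  -- the continuous compactly supported representative `G` of `L(Ψ)` on the strip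
  set G : ℝ × ℝ → ℝ := fun p => -α ^ 2 * p.1 ^ 2 * dz (dz Ψ) p.1 p.2 - α * (5 + α) * p.1 * dz Ψ p.1 p.2 -
    dθ (dθ Ψ) p.1 p.2 + (Real.cos p.2 * χ p.1 p.2 + Real.sin p.2 * dθ χ p.1 p.2) - 6 * Ψ p.1 p.2 with hG
  have cG : Continuous G := by simp only [hG]; fun_prop
  have hGeq : ∀ p ∈ strip, ellipticOp α Ψ p.1 p.2 = G p := by
    intro p hp
    have hcos : Real.cos p.2 ≠ 0 := (Real.cos_pos_of_mem_Ioo ⟨by linarith [hp.2.1, Real.pi_pos], hp.2.2⟩).ne'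
    have hT : Real.cos p.2 * χ p.1 p.2 / Real.cos p.2 ^ 2 +
        Real.sin p.2 * (-Real.sin p.2 * χ p.1 p.2 + Real.cos p.2 * dθ χ p.1 p.2) / Real.cos p.2 =
        Real.cos p.2 * χ p.1 p.2 + Real.sin p.2 * dθ χ p.1 p.2 := by
      rw [div_add_div _ _ (pow_ne_zero 2 hcos) hcos, div_eq_iff (mul_ne_zero (pow_ne_zero 2 hcos) hcos)]
      have := Real.sin_sq_add_cos_sq p.2
      linear_combination (-(Real.cos p.2 ^ 2 * χ p.1 p.2)) * this
    have hΨp : Ψ p.1 p.2 / Real.cos p.2 ^ 2 = Real.cos p.2 * χ p.1 p.2 / Real.cos p.2 ^ 2 := by rw [hΨ]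
    have hdθp : dθ Ψ p.1 p.2 = -Real.sin p.2 * χ p.1 p.2 + Real.cos p.2 * dθ χ p.1 p.2 := by rw [hΨ, dθ_cosProfile hχ1]
    have hud : DifferentiableAt ℝ (fun θ' => Ψ p.1 θ') p.2 :=
      ((hΨ2.comp (contDiff_const.prodMk contDiff_id)).differentiable (by simp)) p.2
    rw [ellipticOp_eq_expanded α hud hcos, hdθp, hΨp, hT]
  have hvaG : ∀ p : ℝ × ℝ, p.1 < a → G p = 0 := fun p hp => by
    simp [hG, hvaχ p hp, hvaΨ p hp, hvadθχ p hp, hvadz p hp, hvadz2 p hp, hvadθ2 p hp]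
  -- Dirichlet data and Step 1 (orthogonality slice-wise)
  have hD0 : ∀ R, Ψ R 0 = 0 := fun R => by rw [hΨ]; simp [hχ0 R]
  have hD1 : ∀ R, Ψ R (π / 2) = 0 := fun R => by rw [hΨ]; simp
  have hK := kMoment_eq_zero_of_ellipticOp_orthogonal hα hΨ2 hΨs hD0 hD1 horth
  -- the two weighted identities
  have hE1 := integral_strip_ellipticOp_mul_self_weight α hWd hχ2 hs hpos hχ0 hΨ
  have hE2 := integral_strip_ellipticOp_mul_neg_dθdθ_weight α hWd hχ hs hpos hχ0 hΨ
  -- generic: continuity, support, integrability of `W(p.1) * g p`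
  have supp_of : ∀ (F : ℝ × ℝ → ℝ) (g : ℝ × ℝ → ℝ), HasCompactSupport g → (∀ p, g p = 0 → F p = 0) → HasCompactSupport F :=
    fun F g hg h => hg.mono fun p hp => by
      contrapose! hp
      simp only [mem_support, ne_eq, not_not] at hp ⊢
      exact h p hp
  have sG : HasCompactSupport G := by
    have hTΨ : tsupport (uncurry Ψ) ⊆ tsupport (uncurry χ) := by
      have e : uncurry Ψ = (fun p : ℝ × ℝ => Real.cos p.2) * uncurry χ := by rw [hΨ]; funext p; rfl
      rw [e]; exact tsupport_mul_subset_right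
    refine HasCompactSupport.of_support_subset_isCompact hs.isCompact fun p hp => ?_
    by_contra hT
    have h1 : χ p.1 p.2 = 0 := image_eq_zero_of_notMem_tsupport (f := uncurry χ) hT
    have h2 : Ψ p.1 p.2 = 0 := image_eq_zero_of_notMem_tsupport (f := uncurry Ψ) fun h => hT (hTΨ h)
    have h3 : dθ χ p.1 p.2 = 0 := image_eq_zero_of_notMem_tsupport (f := uncurry (dθ χ)) fun h => hT (tsupport_dθ_subset' χ h)
    have h4 : dz Ψ p.1 p.2 = 0 := image_eq_zero_of_notMem_tsupport (f := uncurry (dz Ψ)) fun h => hT (hTΨ (tsupport_dz_subset h))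
    have h5 : dz (dz Ψ) p.1 p.2 = 0 := image_eq_zero_of_notMem_tsupport (f := uncurry (dz (dz Ψ))) fun h =>
      hT (hTΨ (tsupport_dz_subset (tsupport_dz_subset h)))
    have h6 : dθ (dθ Ψ) p.1 p.2 = 0 := image_eq_zero_of_notMem_tsupport (f := uncurry (dθ (dθ Ψ))) fun h =>
      hT (hTΨ (tsupport_dθ_subset' Ψ (tsupport_dθ_subset' (dθ Ψ) h)))
    apply hp
    simp [hG, h1, h2, h3, h4, h5, h6]
  -- weighted squares and products: `W g²` with `g` one of the basic quantities
  have wint : ∀ (g : ℝ × ℝ → ℝ), Continuous g → HasCompactSupport g → (∀ p : ℝ × ℝ, p.1 < a → g p = 0) →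
      Integrable (fun p : ℝ × ℝ => W p.1 * g p ^ 2) ∧ Integrable (fun p : ℝ × ℝ => (radialWeight p.1 * g p) ^ 2) := by
    intro g hg hgs hga
    have c1 : Continuous fun p : ℝ × ℝ => W p.1 * g p ^ 2 := continuous_weight_mul₂ hWc (hg.pow 2) ha fun p hp => by simp [hga p hp]
    have s1 : HasCompactSupport fun p : ℝ × ℝ => W p.1 * g p ^ 2 := supp_of _ g hgs fun p hp => by simp [hp]
    have i1 : Integrable fun p : ℝ × ℝ => W p.1 * g p ^ 2 := c1.integrable_of_hasCompactSupport s1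
    refine ⟨i1, i1.congr (ae_of_all _ fun p => by simp only [hW]; ring)⟩
  obtain ⟨iL2, iL2'⟩ := wint G cG sG hvaG
  obtain ⟨iE, iE'⟩ := wint (fun p => Ψ p.1 p.2) cΨ hΨs hvaΨ
  obtain ⟨iY, -⟩ := wint (fun p => dθ Ψ p.1 p.2) cdθ hdθΨs hvadθ
  obtain ⟨iP, iP'⟩ := wint (fun p => dθ (dθ Ψ) p.1 p.2) cdθ2 hdθ2Ψs hvadθ2
  obtain ⟨iQ, -⟩ := wint (fun p => dθ χ p.1 p.2) cdθχ hdθχs hvadθχ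
  obtain ⟨iX, -⟩ := wint (fun p => χ p.1 p.2) cχ hs hvaχ
  have sZ0 : HasCompactSupport fun p : ℝ × ℝ => p.1 * dz Ψ p.1 p.2 := hdzΨs.mul_left (f := fun p : ℝ × ℝ => p.1)
  have sRR0 : HasCompactSupport fun p : ℝ × ℝ => p.1 ^ 2 * dz (dz Ψ) p.1 p.2 := hdz2Ψs.mul_left (f := fun p : ℝ × ℝ => p.1 ^ 2)
  obtain ⟨iZ, -⟩ := wint (fun p : ℝ × ℝ => p.1 * dz Ψ p.1 p.2) (by fun_prop) sZ0 fun p hp => by simp [hvadz p hp]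
  obtain ⟨iRR, -⟩ := wint (fun p : ℝ × ℝ => p.1 ^ 2 * dz (dz Ψ) p.1 p.2) (by fun_prop) sRR0 fun p hp => by
    simp [hvadz2 p hp]
  -- the weight-derivative terms against `W`
  have hM2E : |∫ p in strip, deriv (deriv fun R => R ^ 2 * W R) p.1 * Ψ p.1 p.2 ^ 2| ≤ 6 * ∫ p in strip, W p.1 * Ψ p.1 p.2 ^ 2 := by
    rw [← MeasureTheory.integral_const_mul]
    refine (MeasureTheory.abs_integral_le_integral_abs).trans (setIntegral_mono_on ?_ ?_ measurableSet_strip fun p hp => ?_)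
    · have c1 : Continuous fun p : ℝ × ℝ => deriv (deriv fun R => R ^ 2 * W R) p.1 * Ψ p.1 p.2 ^ 2 :=
        continuous_weight_mul₂ hM2c (cΨ.pow 2) ha fun p hp => by simp [hvaΨ p hp]
      have s1 : HasCompactSupport fun p : ℝ × ℝ => deriv (deriv fun R => R ^ 2 * W R) p.1 * Ψ p.1 p.2 ^ 2 :=
        supp_of _ _ hΨs fun p hp => by simp [show Ψ p.1 p.2 = 0 from hp]
      have i1 : Integrable fun p : ℝ × ℝ => deriv (deriv fun R => R ^ 2 * W R) p.1 * Ψ p.1 p.2 ^ 2 := c1.integrable_of_hasCompactSupport s1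
      exact i1.abs.integrableOn
    · exact (iE.const_mul _).integrableOn
    · rw [abs_mul, abs_of_nonneg (sq_nonneg (Ψ p.1 p.2))]
      have := (hM2 p.1 hp.1)
      rw [abs_of_nonneg this.1, show 6 * (W p.1 * Ψ p.1 p.2 ^ 2) = (6 * W p.1) * Ψ p.1 p.2 ^ 2 by ring]
      exact mul_le_mul_of_nonneg_right this.2 (sq_nonneg _)
  have hN1E : |∫ p in strip, deriv (fun R => R * W R) p.1 * Ψ p.1 p.2 ^ 2| ≤ 3 * ∫ p in strip, W p.1 * Ψ p.1 p.2 ^ 2 := by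
    rw [← MeasureTheory.integral_const_mul]
    refine (MeasureTheory.abs_integral_le_integral_abs).trans (setIntegral_mono_on ?_ ?_ measurableSet_strip fun p hp => ?_)
    · have c1 : Continuous fun p : ℝ × ℝ => deriv (fun R => R * W R) p.1 * Ψ p.1 p.2 ^ 2 :=
        continuous_weight_mul₂ hN1c (cΨ.pow 2) ha fun p hp => by simp [hvaΨ p hp]
      have s1 : HasCompactSupport fun p : ℝ × ℝ => deriv (fun R => R * W R) p.1 * Ψ p.1 p.2 ^ 2 :=
        supp_of _ _ hΨs fun p hp => by simp [show Ψ p.1 p.2 = 0 from hp]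
      have i1 : Integrable fun p : ℝ × ℝ => deriv (fun R => R * W R) p.1 * Ψ p.1 p.2 ^ 2 := c1.integrable_of_hasCompactSupport s1
      exact i1.abs.integrableOn
    · exact (iE.const_mul _).integrableOn
    · rw [abs_mul, abs_of_nonneg (sq_nonneg (Ψ p.1 p.2)), show 3 * (W p.1 * Ψ p.1 p.2 ^ 2) = (3 * W p.1) * Ψ p.1 p.2 ^ 2 by ring]
      exact mul_le_mul_of_nonneg_right (hN1 p.1 hp.1) (sq_nonneg _)
  have hM2Y : |∫ p in strip, deriv (deriv fun R => R ^ 2 * W R) p.1 * dθ Ψ p.1 p.2 ^ 2| ≤ 6 * ∫ p in strip, W p.1 * dθ Ψ p.1 p.2 ^ 2 := by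
    rw [← MeasureTheory.integral_const_mul]
    refine (MeasureTheory.abs_integral_le_integral_abs).trans (setIntegral_mono_on ?_ ?_ measurableSet_strip fun p hp => ?_)
    · have c1 : Continuous fun p : ℝ × ℝ => deriv (deriv fun R => R ^ 2 * W R) p.1 * dθ Ψ p.1 p.2 ^ 2 :=
        continuous_weight_mul₂ hM2c (cdθ.pow 2) ha fun p hp => by simp [hvadθ p hp]
      have s1 : HasCompactSupport fun p : ℝ × ℝ => deriv (deriv fun R => R ^ 2 * W R) p.1 * dθ Ψ p.1 p.2 ^ 2 :=
        supp_of _ _ hdθΨs fun p hp => by simp [show dθ Ψ p.1 p.2 = 0 from hp]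
      have i1 : Integrable fun p : ℝ × ℝ => deriv (deriv fun R => R ^ 2 * W R) p.1 * dθ Ψ p.1 p.2 ^ 2 := c1.integrable_of_hasCompactSupport s1
      exact i1.abs.integrableOn
    · exact (iY.const_mul _).integrableOn
    · rw [abs_mul, abs_of_nonneg (sq_nonneg (dθ Ψ p.1 p.2))]
      have := (hM2 p.1 hp.1)
      rw [abs_of_nonneg this.1, show 6 * (W p.1 * dθ Ψ p.1 p.2 ^ 2) = (6 * W p.1) * dθ Ψ p.1 p.2 ^ 2 by ring]
      exact mul_le_mul_of_nonneg_right this.2 (sq_nonneg _)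
  have hN1Y : |∫ p in strip, deriv (fun R => R * W R) p.1 * dθ Ψ p.1 p.2 ^ 2| ≤ 3 * ∫ p in strip, W p.1 * dθ Ψ p.1 p.2 ^ 2 := by
    rw [← MeasureTheory.integral_const_mul]
    refine (MeasureTheory.abs_integral_le_integral_abs).trans (setIntegral_mono_on ?_ ?_ measurableSet_strip fun p hp => ?_)
    · have c1 : Continuous fun p : ℝ × ℝ => deriv (fun R => R * W R) p.1 * dθ Ψ p.1 p.2 ^ 2 :=
        continuous_weight_mul₂ hN1c (cdθ.pow 2) ha fun p hp => by simp [hvadθ p hp]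
      have s1 : HasCompactSupport fun p : ℝ × ℝ => deriv (fun R => R * W R) p.1 * dθ Ψ p.1 p.2 ^ 2 :=
        supp_of _ _ hdθΨs fun p hp => by simp [show dθ Ψ p.1 p.2 = 0 from hp]
      have i1 : Integrable fun p : ℝ × ℝ => deriv (fun R => R * W R) p.1 * dθ Ψ p.1 p.2 ^ 2 := c1.integrable_of_hasCompactSupport s1
      exact i1.abs.integrableOn
    · exact (iY.const_mul _).integrableOn
    · rw [abs_mul, abs_of_nonneg (sq_nonneg (dθ Ψ p.1 p.2)), show 3 * (W p.1 * dθ Ψ p.1 p.2 ^ 2) = (3 * W p.1) * dθ Ψ p.1 p.2 ^ 2 by ring]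
      exact mul_le_mul_of_nonneg_right (hN1 p.1 hp.1) (sq_nonneg _)
  -- slice-wise constrained Poincaré with the weight: `12 Ew ≤ Yw`
  have hPoinc : 12 * (∫ p in strip, W p.1 * Ψ p.1 p.2 ^ 2) ≤ ∫ p in strip, W p.1 * dθ Ψ p.1 p.2 ^ 2 := by
    have iG : Integrable fun p : ℝ × ℝ => W p.1 * dθ Ψ p.1 p.2 ^ 2 - 12 * (W p.1 * Ψ p.1 p.2 ^ 2) := iY.sub (iE.const_mul _)
    have hslice : ∀ R ∈ Ioi (0 : ℝ), 0 ≤ ∫ θ in Ioo 0 (π / 2), (W R * dθ Ψ R θ ^ 2 - 12 * (W R * Ψ R θ ^ 2)) := by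
      intro R hR
      have huR : ContDiff ℝ 1 fun θ => Ψ R θ := (hΨ2.comp (contDiff_const.prodMk contDiff_id)).of_le (by norm_num)
      have hdu : deriv (fun θ => Ψ R θ) = fun θ => dθ Ψ R θ := rfl
      have horthR : ∫ x in (0 : ℝ)..(π / 2), Ψ R x * (Real.sin x * Real.cos x ^ 2) = 0 := by
        have h := hK R hR
        rw [kMoment_def] at h
        have e : ∫ θ in Ioo 0 (π / 2), Ψ R θ * kernelK θ = 3 * ∫ θ in Ioo 0 (π / 2), Ψ R θ * (Real.sin θ * Real.cos θ ^ 2) := by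
          rw [← MeasureTheory.integral_const_mul]
          refine setIntegral_congr_fun measurableSet_Ioo fun θ _ => ?_
          unfold kernelK; ring
        rw [e] at h
        rw [intervalIntegral.integral_of_le (by positivity), integral_Ioc_eq_integral_Ioo]
        linarith
      have hP := orthogonalMode_poincare huR (hD0 R) (hD1 R) horthR
      rw [hdu] at hP
      rw [intervalIntegral.integral_of_le (by positivity), intervalIntegral.integral_of_le (by positivity),
        integral_Ioc_eq_integral_Ioo, integral_Ioc_eq_integral_Ioo] at hP
      have cu : Continuous fun θ => Ψ R θ := cΨ.comp (Continuous.prodMk_right R)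
      have cdu : Continuous fun θ => dθ Ψ R θ := cdθ.comp (Continuous.prodMk_right R)
      have j1 : IntegrableOn (fun θ => W R * dθ Ψ R θ ^ 2) (Ioo 0 (π / 2)) :=
        (((cdu.pow 2).const_mul _).continuousOn.integrableOn_Icc (a := 0) (b := π / 2)).mono_set Ioo_subset_Icc_self
      have j2 : IntegrableOn (fun θ => 12 * (W R * Ψ R θ ^ 2)) (Ioo 0 (π / 2)) :=
        ((((cu.pow 2).const_mul _).const_mul _).continuousOn.integrableOn_Icc (a := 0) (b := π / 2)).mono_set Ioo_subset_Icc_self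
      rw [integral_sub j1 j2, MeasureTheory.integral_const_mul, MeasureTheory.integral_const_mul, MeasureTheory.integral_const_mul]
      simp only at hP
      have := mul_le_mul_of_nonneg_left hP (hWnn R)
      linarith
    have h0 : 0 ≤ ∫ p in strip, (W p.1 * dθ Ψ p.1 p.2 ^ 2 - 12 * (W p.1 * Ψ p.1 p.2 ^ 2)) := by
      rw [integral_strip_eq_integral_Ioi_integral_Ioo iG]
      exact setIntegral_nonneg measurableSet_Ioi hslice
    have k2 : IntegrableOn (fun p : ℝ × ℝ => 12 * (W p.1 * Ψ p.1 p.2 ^ 2)) strip := (iE.const_mul _).integrableOn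
    rw [integral_sub iY.integrableOn k2, MeasureTheory.integral_const_mul] at h0
    linarith
  -- Cauchy–Schwarz with the weight: `⟨LΨ,ΨW⟩² ≤ L2w Ew`, `⟨LΨ,−Ψ_θθW⟩² ≤ L2w Pw`
  have iGΨ : Integrable fun p : ℝ × ℝ => (radialWeight p.1 * G p) * (radialWeight p.1 * Ψ p.1 p.2) := by
    have c1 : Continuous fun p : ℝ × ℝ => W p.1 * (G p * Ψ p.1 p.2) :=
      continuous_weight_mul₂ hWc (cG.mul cΨ) ha fun p hp => by simp [hvaΨ p hp]
    have s1 : HasCompactSupport fun p : ℝ × ℝ => W p.1 * (G p * Ψ p.1 p.2) := supp_of _ _ hΨs fun p hp => by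
      simp [show Ψ p.1 p.2 = 0 from hp]
    exact (c1.integrable_of_hasCompactSupport s1).congr (ae_of_all _ fun p => by simp only [hW]; ring)
  have iGP : Integrable fun p : ℝ × ℝ => (radialWeight p.1 * G p) * (radialWeight p.1 * (-dθ (dθ Ψ) p.1 p.2)) := by
    have c1 : Continuous fun p : ℝ × ℝ => W p.1 * (G p * (-dθ (dθ Ψ) p.1 p.2)) :=
      continuous_weight_mul₂ hWc (cG.mul cdθ2.neg) ha fun p hp => by simp [hvadθ2 p hp]
    have s1 : HasCompactSupport fun p : ℝ × ℝ => W p.1 * (G p * (-dθ (dθ Ψ) p.1 p.2)) := supp_of _ _ hdθ2Ψs fun p hp => by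
      simp [show dθ (dθ Ψ) p.1 p.2 = 0 from hp]
    exact (c1.integrable_of_hasCompactSupport s1).congr (ae_of_all _ fun p => by simp only [hW]; ring)
  have iP'' : IntegrableOn (fun p : ℝ × ℝ => (radialWeight p.1 * (-dθ (dθ Ψ) p.1 p.2)) ^ 2) strip :=
    (iP'.integrableOn (s := strip)).congr_fun (fun p _ => by ring) measurableSet_strip
  have hCS1 := sq_integral_mul_le (μ := volume.restrict strip) iL2'.integrableOn iE'.integrableOn iGΨ.integrableOn
  have hCS2 := sq_integral_mul_le (μ := volume.restrict strip) iL2'.integrableOn iP'' iGP.integrableOn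
  -- identify the weighted pairings with the left-hand sides of the identities
  have eI1 : ∫ p in strip, ellipticOp α Ψ p.1 p.2 * Ψ p.1 p.2 * W p.1 =
      ∫ p in strip, (radialWeight p.1 * G p) * (radialWeight p.1 * Ψ p.1 p.2) :=
    setIntegral_congr_fun measurableSet_strip fun p hp => by rw [hGeq p hp]; simp only [hW]; ring
  have eI2 : ∫ p in strip, ellipticOp α Ψ p.1 p.2 * (-dθ (dθ Ψ) p.1 p.2) * W p.1 =
      ∫ p in strip, (radialWeight p.1 * G p) * (radialWeight p.1 * (-dθ (dθ Ψ) p.1 p.2)) :=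
    setIntegral_congr_fun measurableSet_strip fun p hp => by rw [hGeq p hp]; simp only [hW]; ring
  have eL2 : ∫ p in strip, radialWeight p.1 ^ 2 * ellipticOp α Ψ p.1 p.2 ^ 2 = ∫ p in strip, (radialWeight p.1 * G p) ^ 2 :=
    setIntegral_congr_fun measurableSet_strip fun p hp => by rw [hGeq p hp]; ring
  have eEw : ∫ p in strip, (radialWeight p.1 * Ψ p.1 p.2) ^ 2 = ∫ p in strip, W p.1 * Ψ p.1 p.2 ^ 2 :=
    integral_congr_ae (ae_of_all _ fun p => by simp only [hW]; ring)
  have ePw : ∫ p in strip, (radialWeight p.1 * (-dθ (dθ Ψ) p.1 p.2)) ^ 2 = ∫ p in strip, W p.1 * dθ (dθ Ψ) p.1 p.2 ^ 2 :=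
    integral_congr_ae (ae_of_all _ fun p => by simp only [hW]; ring)
  rw [eEw] at hCS1
  rw [ePw] at hCS2
  rw [eI1] at hE1
  rw [eI2] at hE2
  -- nonnegativity of the basic weighted quantities
  have hL2nn : 0 ≤ ∫ p in strip, (radialWeight p.1 * G p) ^ 2 := integral_nonneg fun p => sq_nonneg _
  have hEnn : 0 ≤ ∫ p in strip, W p.1 * Ψ p.1 p.2 ^ 2 := integral_nonneg fun p => mul_nonneg (hWnn _) (sq_nonneg _)
  have hYnn : 0 ≤ ∫ p in strip, W p.1 * dθ Ψ p.1 p.2 ^ 2 := integral_nonneg fun p => mul_nonneg (hWnn _) (sq_nonneg _)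
  have hPnn : 0 ≤ ∫ p in strip, W p.1 * dθ (dθ Ψ) p.1 p.2 ^ 2 := integral_nonneg fun p => mul_nonneg (hWnn _) (sq_nonneg _)
  have hQnn : 0 ≤ ∫ p in strip, W p.1 * dθ χ p.1 p.2 ^ 2 := integral_nonneg fun p => mul_nonneg (hWnn _) (sq_nonneg _)
  have hXnn : 0 ≤ ∫ p in strip, W p.1 * χ p.1 p.2 ^ 2 := integral_nonneg fun p => mul_nonneg (hWnn _) (sq_nonneg _)
  have hZnn : 0 ≤ ∫ p in strip, W p.1 * (p.1 * dz Ψ p.1 p.2) ^ 2 := integral_nonneg fun p => mul_nonneg (hWnn _) (sq_nonneg _)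
  have hZ2nn : 0 ≤ ∫ p in strip, W p.1 * (p.1 * dz (dθ Ψ) p.1 p.2) ^ 2 := integral_nonneg fun p => mul_nonneg (hWnn _) (sq_nonneg _)
  -- the coefficient bounds for `α ≤ 1/4`
  have hcoefE : α ^ 2 / 2 * 6 + α * (5 + α) / 2 * 3 ≤ 11 / 5 := step1_coef_bound hα.le hα4
  have hcE : (0 : ℝ) ≤ α * (5 + α) / 2 := by positivity
  have hM2E' := abs_le.1 hM2E
  have hN1E' := abs_le.1 hN1E
  have hM2Y' := abs_le.1 hM2Y
  have hN1Y' := abs_le.1 hN1Y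
  -- (1) weighted `L²`: `(19/60) Yw ≤ ⟨…⟩`
  have hlow1 : (19 / 60) * (∫ p in strip, W p.1 * dθ Ψ p.1 p.2 ^ 2) ≤
      ∫ p in strip, (radialWeight p.1 * G p) * (radialWeight p.1 * Ψ p.1 p.2) := by
    have t1 : α ^ 2 / 2 * (∫ p in strip, deriv (deriv fun R => R ^ 2 * W R) p.1 * Ψ p.1 p.2 ^ 2) ≤
        α ^ 2 / 2 * (6 * ∫ p in strip, W p.1 * Ψ p.1 p.2 ^ 2) := mul_le_mul_of_nonneg_left hM2E'.2 (by positivity)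
    have t2 : -(α * (5 + α) / 2 * (∫ p in strip, deriv (fun R => R * W R) p.1 * Ψ p.1 p.2 ^ 2)) ≤
        α * (5 + α) / 2 * (3 * ∫ p in strip, W p.1 * Ψ p.1 p.2 ^ 2) := by
      have u := mul_le_mul_of_nonneg_left hN1E'.1 hcE
      linarith [u]
    have t3 : (α ^ 2 / 2 * 6 + α * (5 + α) / 2 * 3) * (∫ p in strip, W p.1 * Ψ p.1 p.2 ^ 2) ≤ (11 / 5) * ∫ p in strip, W p.1 * Ψ p.1 p.2 ^ 2 :=
      mul_le_mul_of_nonneg_right hcoefE hEnn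
    have t4 : 0 ≤ α ^ 2 * ∫ p in strip, W p.1 * (p.1 * dz Ψ p.1 p.2) ^ 2 := mul_nonneg (sq_nonneg _) hZnn
    linarith [hE1, hPoinc, hXnn]
  have hYw : (∫ p in strip, W p.1 * dθ Ψ p.1 p.2 ^ 2) ≤ ∫ p in strip, (radialWeight p.1 * G p) ^ 2 :=
    weighted_l2_algebra hL2nn hlow1 hCS1 (by linarith [hPoinc])
  have hEw : (∫ p in strip, W p.1 * Ψ p.1 p.2 ^ 2) ≤ (1 / 12) * ∫ p in strip, (radialWeight p.1 * G p) ^ 2 := by linarith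
  -- (2) weighted `H²`
  have hmain2 : (∫ p in strip, W p.1 * dθ (dθ Ψ) p.1 p.2 ^ 2) + (3 / 2) * (∫ p in strip, W p.1 * dθ χ p.1 p.2 ^ 2) ≤
      (∫ p in strip, (radialWeight p.1 * G p) * (radialWeight p.1 * (-dθ (dθ Ψ) p.1 p.2))) +
        (41 / 5) * ∫ p in strip, W p.1 * dθ Ψ p.1 p.2 ^ 2 := by
    have t1 : α ^ 2 / 2 * (∫ p in strip, deriv (deriv fun R => R ^ 2 * W R) p.1 * dθ Ψ p.1 p.2 ^ 2) ≤
        α ^ 2 / 2 * (6 * ∫ p in strip, W p.1 * dθ Ψ p.1 p.2 ^ 2) := mul_le_mul_of_nonneg_left hM2Y'.2 (by positivity)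
    have t2 : -(α * (5 + α) / 2 * (∫ p in strip, deriv (fun R => R * W R) p.1 * dθ Ψ p.1 p.2 ^ 2)) ≤
        α * (5 + α) / 2 * (3 * ∫ p in strip, W p.1 * dθ Ψ p.1 p.2 ^ 2) := by
      have u := mul_le_mul_of_nonneg_left hN1Y'.1 hcE
      linarith [u]
    have t3 : (α ^ 2 / 2 * 6 + α * (5 + α) / 2 * 3) * (∫ p in strip, W p.1 * dθ Ψ p.1 p.2 ^ 2) ≤ (11 / 5) * ∫ p in strip, W p.1 * dθ Ψ p.1 p.2 ^ 2 :=
      mul_le_mul_of_nonneg_right hcoefE hYnn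
    have t4 : 0 ≤ α ^ 2 * ∫ p in strip, W p.1 * (p.1 * dz (dθ Ψ) p.1 p.2) ^ 2 := mul_nonneg (sq_nonneg _) hZ2nn
    linarith [hE2, hXnn]
  obtain ⟨hPw, hQw⟩ := weighted_h2_algebra hPnn hQnn hL2nn hmain2 hCS2 hYw
  -- (2') the mixed derivative `α²‖wRΨ_{Rθ}‖²` kept in the second identity
  have hmain2' : α ^ 2 * (∫ p in strip, W p.1 * (p.1 * dz (dθ Ψ) p.1 p.2) ^ 2) +
      (∫ p in strip, W p.1 * dθ (dθ Ψ) p.1 p.2 ^ 2) + (3 / 2) * (∫ p in strip, W p.1 * dθ χ p.1 p.2 ^ 2) ≤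
      (∫ p in strip, (radialWeight p.1 * G p) * (radialWeight p.1 * (-dθ (dθ Ψ) p.1 p.2))) +
        (41 / 5) * ∫ p in strip, W p.1 * dθ Ψ p.1 p.2 ^ 2 := by
    have t1 : α ^ 2 / 2 * (∫ p in strip, deriv (deriv fun R => R ^ 2 * W R) p.1 * dθ Ψ p.1 p.2 ^ 2) ≤
        α ^ 2 / 2 * (6 * ∫ p in strip, W p.1 * dθ Ψ p.1 p.2 ^ 2) := mul_le_mul_of_nonneg_left hM2Y'.2 (by positivity)
    have t2 : -(α * (5 + α) / 2 * (∫ p in strip, deriv (fun R => R * W R) p.1 * dθ Ψ p.1 p.2 ^ 2)) ≤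
        α * (5 + α) / 2 * (3 * ∫ p in strip, W p.1 * dθ Ψ p.1 p.2 ^ 2) := by
      have u := mul_le_mul_of_nonneg_left hN1Y'.1 hcE
      linarith [u]
    have t3 : (α ^ 2 / 2 * 6 + α * (5 + α) / 2 * 3) * (∫ p in strip, W p.1 * dθ Ψ p.1 p.2 ^ 2) ≤ (11 / 5) * ∫ p in strip, W p.1 * dθ Ψ p.1 p.2 ^ 2 :=
      mul_le_mul_of_nonneg_right hcoefE hYnn
    linarith [hE2, hXnn]
  have hMix : α ^ 2 * (∫ p in strip, W p.1 * (p.1 * dz (dθ Ψ) p.1 p.2) ^ 2) ≤ 12 * ∫ p in strip, (radialWeight p.1 * G p) ^ 2 :=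
    weighted_mixed_algebra hPnn hQnn hL2nn hmain2' hCS2 hPw hYw
  -- (3) the radial first-order term and `‖wχ‖²` from the first identity
  have hI1 : (∫ p in strip, (radialWeight p.1 * G p) * (radialWeight p.1 * Ψ p.1 p.2)) ≤ (1 / 3) * ∫ p in strip, (radialWeight p.1 * G p) ^ 2 := by
    by_contra hlt
    have hlt' := not_le.1 hlt
    have h1 : ((1 / 3) * ∫ p in strip, (radialWeight p.1 * G p) ^ 2) ^ 2 <
        (∫ p in strip, (radialWeight p.1 * G p) * (radialWeight p.1 * Ψ p.1 p.2)) ^ 2 :=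
      pow_lt_pow_left₀ hlt' (by positivity) two_ne_zero
    have h2 := hCS1.trans (mul_le_mul_of_nonneg_left hEw hL2nn)
    linarith [sq_nonneg (∫ p in strip, (radialWeight p.1 * G p) ^ 2)]
  have hRad : α ^ 2 * (∫ p in strip, W p.1 * (p.1 * dz Ψ p.1 p.2) ^ 2) ≤ ∫ p in strip, (radialWeight p.1 * G p) ^ 2 ∧
      (∫ p in strip, W p.1 * χ p.1 p.2 ^ 2) ≤ 2 * ∫ p in strip, (radialWeight p.1 * G p) ^ 2 := by
    have t1 : α ^ 2 / 2 * (∫ p in strip, deriv (deriv fun R => R ^ 2 * W R) p.1 * Ψ p.1 p.2 ^ 2) ≤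
        α ^ 2 / 2 * (6 * ∫ p in strip, W p.1 * Ψ p.1 p.2 ^ 2) := mul_le_mul_of_nonneg_left hM2E'.2 (by positivity)
    have t1' : -(α ^ 2 / 2 * (∫ p in strip, deriv (deriv fun R => R ^ 2 * W R) p.1 * Ψ p.1 p.2 ^ 2)) ≤
        α ^ 2 / 2 * (6 * ∫ p in strip, W p.1 * Ψ p.1 p.2 ^ 2) := by
      have u := mul_le_mul_of_nonneg_left hM2E'.1 (by positivity : (0 : ℝ) ≤ α ^ 2 / 2)
      linarith [u]
    have t2 : -(α * (5 + α) / 2 * (∫ p in strip, deriv (fun R => R * W R) p.1 * Ψ p.1 p.2 ^ 2)) ≤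
        α * (5 + α) / 2 * (3 * ∫ p in strip, W p.1 * Ψ p.1 p.2 ^ 2) := by
      have u := mul_le_mul_of_nonneg_left hN1E'.1 hcE
      linarith [u]
    have t2' : α * (5 + α) / 2 * (∫ p in strip, deriv (fun R => R * W R) p.1 * Ψ p.1 p.2 ^ 2) ≤
        α * (5 + α) / 2 * (3 * ∫ p in strip, W p.1 * Ψ p.1 p.2 ^ 2) := mul_le_mul_of_nonneg_left hN1E'.2 hcE
    have t3 : (α ^ 2 / 2 * 6 + α * (5 + α) / 2 * 3) * (∫ p in strip, W p.1 * Ψ p.1 p.2 ^ 2) ≤ (11 / 5) * ∫ p in strip, W p.1 * Ψ p.1 p.2 ^ 2 :=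
      mul_le_mul_of_nonneg_right hcoefE hEnn
    have t4 : 0 ≤ α ^ 2 * ∫ p in strip, W p.1 * (p.1 * dz Ψ p.1 p.2) ^ 2 := mul_nonneg (sq_nonneg _) hZnn
    constructor <;> linarith [hE1, hI1, hEw, hYnn, hXnn]
  -- (4) the radial second-order term by difference
  have hpt : ∀ p : ℝ × ℝ, W p.1 * (α ^ 2 * (p.1 ^ 2 * dz (dz Ψ) p.1 p.2)) ^ 2 ≤
      6 * ((radialWeight p.1 * G p) ^ 2 + 36 * (α ^ 2 * (W p.1 * (p.1 * dz Ψ p.1 p.2) ^ 2)) + W p.1 * dθ (dθ Ψ) p.1 p.2 ^ 2 +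
        W p.1 * χ p.1 p.2 ^ 2 + W p.1 * dθ χ p.1 p.2 ^ 2 + 36 * (W p.1 * Ψ p.1 p.2 ^ 2)) := by
    intro p
    have e : α ^ 2 * (p.1 ^ 2 * dz (dz Ψ) p.1 p.2) = -G p + -(α * (5 + α) * (p.1 * dz Ψ p.1 p.2)) + -dθ (dθ Ψ) p.1 p.2 +
        Real.cos p.2 * χ p.1 p.2 + Real.sin p.2 * dθ χ p.1 p.2 + -(6 * Ψ p.1 p.2) := by
      simp only [hG]; ring
    rw [e]
    have h := radial_pointwise_bound hα.le hα1 (Real.cos_sq_le_one p.2) (Real.sin_sq_le_one p.2) (G p) (p.1 * dz Ψ p.1 p.2)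
      (dθ (dθ Ψ) p.1 p.2) (χ p.1 p.2) (dθ χ p.1 p.2) (Ψ p.1 p.2)
    have hw := hWnn p.1
    have := mul_le_mul_of_nonneg_left h hw
    calc W p.1 * (-G p + -(α * (5 + α) * (p.1 * dz Ψ p.1 p.2)) + -dθ (dθ Ψ) p.1 p.2 + Real.cos p.2 * χ p.1 p.2 +
          Real.sin p.2 * dθ χ p.1 p.2 + -(6 * Ψ p.1 p.2)) ^ 2
        ≤ W p.1 * (6 * (G p ^ 2 + 36 * (α ^ 2 * (p.1 * dz Ψ p.1 p.2) ^ 2) + dθ (dθ Ψ) p.1 p.2 ^ 2 + χ p.1 p.2 ^ 2 +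
            dθ χ p.1 p.2 ^ 2 + 36 * Ψ p.1 p.2 ^ 2)) := this
      _ = _ := by simp only [hW]; ring
  have iLHS : Integrable fun p : ℝ × ℝ => W p.1 * (α ^ 2 * (p.1 ^ 2 * dz (dz Ψ) p.1 p.2)) ^ 2 := by
    refine (iRR.const_mul (α ^ 4)).congr (ae_of_all _ fun p => by ring)
  have iRHS : Integrable fun p : ℝ × ℝ => 6 * ((radialWeight p.1 * G p) ^ 2 + 36 * (α ^ 2 * (W p.1 * (p.1 * dz Ψ p.1 p.2) ^ 2)) +
      W p.1 * dθ (dθ Ψ) p.1 p.2 ^ 2 + W p.1 * χ p.1 p.2 ^ 2 + W p.1 * dθ χ p.1 p.2 ^ 2 + 36 * (W p.1 * Ψ p.1 p.2 ^ 2)) :=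
    (((((iL2'.add ((iZ.const_mul _).const_mul _)).add iP).add iX).add iQ).add (iE.const_mul _)).const_mul _
  have hmono := setIntegral_mono_on (s := strip) iLHS.integrableOn iRHS.integrableOn measurableSet_strip fun p _ => hpt p
  have k1 : IntegrableOn (fun p : ℝ × ℝ => (radialWeight p.1 * G p) ^ 2 + 36 * (α ^ 2 * (W p.1 * (p.1 * dz Ψ p.1 p.2) ^ 2))) strip :=
    (iL2'.add ((iZ.const_mul _).const_mul _)).integrableOn
  have k2 : IntegrableOn (fun p : ℝ × ℝ => (radialWeight p.1 * G p) ^ 2 + 36 * (α ^ 2 * (W p.1 * (p.1 * dz Ψ p.1 p.2) ^ 2)) +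
      W p.1 * dθ (dθ Ψ) p.1 p.2 ^ 2) strip := k1.add iP.integrableOn
  have k3 : IntegrableOn (fun p : ℝ × ℝ => (radialWeight p.1 * G p) ^ 2 + 36 * (α ^ 2 * (W p.1 * (p.1 * dz Ψ p.1 p.2) ^ 2)) +
      W p.1 * dθ (dθ Ψ) p.1 p.2 ^ 2 + W p.1 * χ p.1 p.2 ^ 2) strip := k2.add iX.integrableOn
  have k4 : IntegrableOn (fun p : ℝ × ℝ => (radialWeight p.1 * G p) ^ 2 + 36 * (α ^ 2 * (W p.1 * (p.1 * dz Ψ p.1 p.2) ^ 2)) +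
      W p.1 * dθ (dθ Ψ) p.1 p.2 ^ 2 + W p.1 * χ p.1 p.2 ^ 2 + W p.1 * dθ χ p.1 p.2 ^ 2) strip := k3.add iQ.integrableOn
  have kZ : IntegrableOn (fun p : ℝ × ℝ => 36 * (α ^ 2 * (W p.1 * (p.1 * dz Ψ p.1 p.2) ^ 2))) strip := ((iZ.const_mul _).const_mul _).integrableOn
  have kE : IntegrableOn (fun p : ℝ × ℝ => 36 * (W p.1 * Ψ p.1 p.2 ^ 2)) strip := (iE.const_mul _).integrableOn
  rw [MeasureTheory.integral_const_mul, integral_add k4 kE, integral_add k3 iQ.integrableOn, integral_add k2 iX.integrableOn,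
    integral_add k1 iP.integrableOn, integral_add iL2'.integrableOn kZ, MeasureTheory.integral_const_mul,
    MeasureTheory.integral_const_mul, MeasureTheory.integral_const_mul] at hmono
  have eLHS : ∫ p in strip, W p.1 * (α ^ 2 * (p.1 ^ 2 * dz (dz Ψ) p.1 p.2)) ^ 2 = α ^ 4 * ∫ p in strip, W p.1 * (p.1 ^ 2 * dz (dz Ψ) p.1 p.2) ^ 2 := by
    rw [← MeasureTheory.integral_const_mul]
    exact integral_congr_ae (ae_of_all _ fun p => by ring)
  rw [eLHS] at hmono
  have hRR : α ^ 4 * (∫ p in strip, W p.1 * (p.1 ^ 2 * dz (dz Ψ) p.1 p.2) ^ 2) ≤ 372 * ∫ p in strip, (radialWeight p.1 * G p) ^ 2 := by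
    linarith [hmono, hRad.1, hRad.2, hPw, hQw, hEw, hL2nn]
  -- conclude (rewrite the weight back)
  rw [eL2]
  simp only [hW] at hYw hEw hPw hQw hRad hRR hMix ⊢
  exact ⟨hYw, hEw, hPw, hQw, hRad.1, hRR, hMix, hRad.2⟩

end Elgindi

end Literature.Analysis.FluidPDE
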